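import Mathlib

/-!
# `¬ CascadeCore` — the equal-swap geometric relay chain, general `m₀` (triage r1 k3 evidence)

Definitions `ExchangeStep … CascadeCore` copied VERBATIM from
`Cruxes/DiffuseBackwardInfluence/IdeatorOneG2Sketch.lean` §1 (card `relay-cascade-bfk`).
Theorem `not_cascadeCore : ¬ CascadeCore`: for `c₀ = 1/10`, `C K = K²`, `η = 7` no `m₀` works.
Witness for a given `m₀`: `d = m₀ + 1`, particles `Fin (d+1)`, masses `a_k = h·(1/9)^k` with
`h = 3 / Σ_{k≤d} 9^{-k} ≥ 8/3`, history = `d` rounds of `(0,1),(1,2),…,(d−1,d)`, step `(k,k+1)` with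
`e = w = a_k/10` (an equal swap: `k` gives fraction `1/10`, `k+1` gives fraction `9/10`).
-/

namespace Summit.AtomisticToContinuum.HydrodynamicLimit.Cruxes.DiffuseBackwardInfluence.TriageR1K3General

open scoped BigOperators

noncomputable section

/-! ## Verbatim copies from `IdeatorOneG2Sketch.lean` §1 -/

structure ExchangeStep (n : ℕ) where
  i : Fin n
  j : Fin n
  e : ℝ
  w : ℝ

def applyStep {n : ℕ} (a : Fin n → ℝ) (s : ExchangeStep n) : Fin n → ℝ :=
  Function.update (Function.update a s.i (a s.i - s.e + s.w)) s.j (a s.j - s.w + s.e)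

def massesAfter {n : ℕ} (a : Fin n → ℝ) (L : List (ExchangeStep n)) : Fin n → ℝ :=
  L.foldl applyStep a

def massesBefore {n : ℕ} (a : Fin n → ℝ) (L : List (ExchangeStep n)) (m : ℕ) : Fin n → ℝ :=
  massesAfter a (L.take m)

def Admissible {n : ℕ} (a : Fin n → ℝ) (L : List (ExchangeStep n)) : Prop :=
  ∀ m (hm : m < L.length),
    let s := L.get ⟨m, hm⟩
    let b := massesBefore a L m
    s.i ≠ s.j ∧ 0 ≤ s.e ∧ s.e ≤ b s.i ∧ 0 ≤ s.w ∧ s.w ≤ b s.j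

def FullyNonDegenerate {n : ℕ} (c₀ : ℝ) (a : Fin n → ℝ) (L : List (ExchangeStep n)) : Prop :=
  ∀ m (hm : m < L.length),
    let s := L.get ⟨m, hm⟩
    let b := massesBefore a L m
    c₀ * b s.i ≤ s.e ∧ s.e ≤ (1 - c₀) * b s.i ∧ c₀ * b s.j ≤ s.w ∧ s.w ≤ (1 - c₀) * b s.j

def LocalityBFK {n : ℕ} (C : ℕ → ℕ) (L : List (ExchangeStep n)) : Prop :=
  ∀ (S : Finset (Fin n)) (m₁ m₂ : ℕ), m₁ ≤ m₂ → m₂ ≤ L.length →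
    (∀ m (hm : m < L.length), m₁ ≤ m → m < m₂ →
      ((L.get ⟨m, hm⟩).i ∈ S ↔ (L.get ⟨m, hm⟩).j ∈ S)) →
    ((Finset.range L.length).filter (fun m => m₁ ≤ m ∧ m < m₂ ∧
        ∃ hm : m < L.length, (L.get ⟨m, hm⟩).i ∈ S ∧ (L.get ⟨m, hm⟩).j ∈ S)).card ≤ C S.card

def stepsOf {n : ℕ} (L : List (ExchangeStep n)) (i : Fin n) : ℕ :=
  (L.filter (fun s => decide (s.i = i ∨ s.j = i))).length

def CascadeCore : Prop :=
  ∀ c₀ : ℝ, 0 < c₀ → c₀ < 1 / 3 → ∀ C : ℕ → ℕ, ∀ η : ℝ, 0 < η → ∃ m₀ : ℕ,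
    ∀ (n : ℕ) (a : Fin n → ℝ) (L : List (ExchangeStep n)),
      (∀ i, 0 ≤ a i) → ∑ i, a i = 3 → Admissible a L → FullyNonDegenerate c₀ a L →
      LocalityBFK C L → (∀ i, m₀ ≤ stepsOf L i) →
      ∑ i, (massesAfter a L i) ^ 2 ≤ η

/-! ## Balanced (equal-swap) steps leave every mass unchanged -/

theorem applyStep_of_balanced {n : ℕ} (a : Fin n → ℝ) (s : ExchangeStep n) (h : s.e = s.w) :
    applyStep a s = a := by
  unfold applyStep
  rw [h]
  simp only [sub_add_cancel, Function.update_eq_self]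

theorem massesAfter_of_balanced {n : ℕ} (a : Fin n → ℝ) (L : List (ExchangeStep n))
    (h : ∀ s ∈ L, s.e = s.w) : massesAfter a L = a := by
  induction L generalizing a with
  | nil => rfl
  | cons s L ih =>
    show massesAfter (applyStep a s) L = a
    rw [applyStep_of_balanced a s (h s List.mem_cons_self)]
    exact ih a (fun s' hs' => h s' (List.mem_cons_of_mem _ hs'))

theorem massesBefore_of_balanced {n : ℕ} (a : Fin n → ℝ) (L : List (ExchangeStep n))
    (h : ∀ s ∈ L, s.e = s.w) (m : ℕ) : massesBefore a L m = a :=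
  massesAfter_of_balanced a _ (fun s hs => h s (List.mem_of_mem_take hs))

/-! ## The geometric mass profile -/

/-- `Σ_{k ≤ d} 9^{-k}`. -/
def gsum (d : ℕ) : ℝ := ∑ k ∈ Finset.range (d + 1), (1 / 9 : ℝ) ^ k

theorem gsum_pos (d : ℕ) : 0 < gsum d :=
  Finset.sum_pos (fun k _ => by positivity) ⟨0, by simp⟩

theorem gsum_le (d : ℕ) : gsum d ≤ 9 / 8 := by
  unfold gsum
  rw [geom_sum_eq (by norm_num : (1 / 9 : ℝ) ≠ 1)]
  have h0 : (0 : ℝ) ≤ (1 / 9 : ℝ) ^ (d + 1) := by positivity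
  rw [div_le_iff_of_neg (by norm_num : (1 / 9 : ℝ) - 1 < 0)]
  linarith

/-- The heavy holder's mass `h = 3 / gsum d ∈ [8/3, 3]`. -/
def hmass (d : ℕ) : ℝ := 3 / gsum d

theorem hmass_pos (d : ℕ) : 0 < hmass d := div_pos (by norm_num) (gsum_pos d)

theorem hmass_ge (d : ℕ) : 8 / 3 ≤ hmass d := by
  unfold hmass
  rw [le_div_iff₀ (gsum_pos d)]
  have := gsum_le d
  linarith

/-- Masses `a_k = h · 9^{-k}` on the chain `0, …, d`. -/
def mass (d : ℕ) (k : Fin (d + 1)) : ℝ := hmass d * (1 / 9 : ℝ) ^ (k : ℕ)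

theorem mass_nonneg (d : ℕ) : ∀ k, 0 ≤ mass d k := fun k => by
  unfold mass; have := hmass_pos d; positivity

theorem mass_sum (d : ℕ) : ∑ k, mass d k = 3 := by
  unfold mass
  rw [← Finset.mul_sum, Fin.sum_univ_eq_sum_range (fun k => (1 / 9 : ℝ) ^ k) (d + 1)]
  show hmass d * gsum d = 3
  unfold hmass
  exact div_mul_cancel₀ 3 (gsum_pos d).ne'

theorem mass_zero (d : ℕ) : mass d 0 = hmass d := by simp [mass]

/-! ## The round-robin history -/

section Hist

variable (d : ℕ) (hd : 0 < d)

/-- First endpoint of the step at position `m`: particle `m % d`. -/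
def idxI (m : ℕ) : Fin (d + 1) := ⟨m % d, (Nat.mod_lt m hd).trans (Nat.lt_succ_self d)⟩

/-- Second endpoint: particle `m % d + 1`. -/
def idxJ (m : ℕ) : Fin (d + 1) := ⟨m % d + 1, Nat.succ_lt_succ (Nat.mod_lt m hd)⟩

/-- The step at position `m`: pair `(m % d, m % d + 1)`, equal swap of `a_{m % d}/10`. -/
def stepAt (m : ℕ) : ExchangeStep (d + 1) :=
  ⟨idxI d hd m, idxJ d hd m, (1 / 10 : ℝ) * mass d (idxI d hd m), (1 / 10 : ℝ) * mass d (idxI d hd m)⟩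

/-- `R` rounds of `(0,1),(1,2),…,(d−1,d)`. -/
def hist (R : ℕ) : List (ExchangeStep (d + 1)) := (List.range (R * d)).map (stepAt d hd)

theorem hist_length (R : ℕ) : (hist d hd R).length = R * d := by simp [hist]

theorem hist_get (R m : ℕ) (hm : m < (hist d hd R).length) :
    (hist d hd R).get ⟨m, hm⟩ = stepAt d hd m := by
  simp [hist]

theorem hist_balanced (R : ℕ) : ∀ s ∈ hist d hd R, s.e = s.w := by
  intro s hs
  obtain ⟨m, -, rfl⟩ := List.mem_map.1 hs
  rfl

theorem massesAfter_hist (R : ℕ) : massesAfter (mass d) (hist d hd R) = mass d :=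
  massesAfter_of_balanced _ _ (hist_balanced d hd R)

theorem massesBefore_hist (R m : ℕ) : massesBefore (mass d) (hist d hd R) m = mass d :=
  massesBefore_of_balanced _ _ (hist_balanced d hd R) m

theorem idxI_ne_idxJ (m : ℕ) : idxI d hd m ≠ idxJ d hd m := by
  intro h
  have := congrArg Fin.val h
  simp only [idxI, idxJ] at this
  omega

theorem mass_idxJ (m : ℕ) : mass d (idxJ d hd m) = (1 / 9 : ℝ) * mass d (idxI d hd m) := by
  simp only [mass, idxI, idxJ, pow_succ]
  ring

theorem admissible_hist (R : ℕ) : Admissible (mass d) (hist d hd R) := by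
  intro m hm
  show ((hist d hd R).get ⟨m, hm⟩).i ≠ ((hist d hd R).get ⟨m, hm⟩).j ∧
    0 ≤ ((hist d hd R).get ⟨m, hm⟩).e ∧
    ((hist d hd R).get ⟨m, hm⟩).e ≤ massesBefore (mass d) (hist d hd R) m ((hist d hd R).get ⟨m, hm⟩).i ∧
    0 ≤ ((hist d hd R).get ⟨m, hm⟩).w ∧
    ((hist d hd R).get ⟨m, hm⟩).w ≤ massesBefore (mass d) (hist d hd R) m ((hist d hd R).get ⟨m, hm⟩).j
  rw [massesBefore_hist, hist_get]
  have hj : mass d (stepAt d hd m).j = (1 / 9 : ℝ) * mass d (stepAt d hd m).i := mass_idxJ d hd m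
  have he : (stepAt d hd m).e = (1 / 10 : ℝ) * mass d (stepAt d hd m).i := rfl
  have hw : (stepAt d hd m).w = (1 / 10 : ℝ) * mass d (stepAt d hd m).i := rfl
  have hx := mass_nonneg d (stepAt d hd m).i
  rw [hj, he, hw]
  refine ⟨idxI_ne_idxJ d hd m, ?_, ?_, ?_, ?_⟩ <;> nlinarith

theorem fullyND_hist (R : ℕ) : FullyNonDegenerate (1 / 10) (mass d) (hist d hd R) := by
  intro m hm
  show (1 / 10 : ℝ) * massesBefore (mass d) (hist d hd R) m ((hist d hd R).get ⟨m, hm⟩).i ≤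
      ((hist d hd R).get ⟨m, hm⟩).e ∧
    ((hist d hd R).get ⟨m, hm⟩).e ≤
      (1 - 1 / 10) * massesBefore (mass d) (hist d hd R) m ((hist d hd R).get ⟨m, hm⟩).i ∧
    (1 / 10 : ℝ) * massesBefore (mass d) (hist d hd R) m ((hist d hd R).get ⟨m, hm⟩).j ≤
      ((hist d hd R).get ⟨m, hm⟩).w ∧
    ((hist d hd R).get ⟨m, hm⟩).w ≤
      (1 - 1 / 10) * massesBefore (mass d) (hist d hd R) m ((hist d hd R).get ⟨m, hm⟩).j
  rw [massesBefore_hist, hist_get]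
  have hj : mass d (stepAt d hd m).j = (1 / 9 : ℝ) * mass d (stepAt d hd m).i := mass_idxJ d hd m
  have he : (stepAt d hd m).e = (1 / 10 : ℝ) * mass d (stepAt d hd m).i := rfl
  have hw : (stepAt d hd m).w = (1 / 10 : ℝ) * mass d (stepAt d hd m).i := rfl
  have hx := mass_nonneg d (stepAt d hd m).i
  rw [hj, he, hw]
  refine ⟨le_rfl, ?_, ?_, ?_⟩ <;> nlinarith

/-- Every particle takes at least one step per round. -/
theorem stepsOf_hist_ge (R : ℕ) (p : Fin (d + 1)) : R ≤ stepsOf (hist d hd R) p := by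
  unfold stepsOf hist
  rw [List.filter_map, List.length_map, ← List.countP_eq_length_filter]
  induction R with
  | zero => exact Nat.zero_le _
  | succ R ih =>
    rw [Nat.succ_mul, List.range_add, List.countP_append]
    have hone : 1 ≤ List.countP ((fun s => decide (s.i = p ∨ s.j = p)) ∘ stepAt d hd)
        (List.map (fun x => R * d + x) (List.range d)) := by
      rw [Nat.one_le_iff_ne_zero, ← Nat.pos_iff_ne_zero, List.countP_pos_iff]
      by_cases hp : (p : ℕ) < d
      · refine ⟨R * d + p, List.mem_map.2 ⟨p, List.mem_range.2 hp, rfl⟩, ?_⟩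
        simp only [Function.comp_apply, decide_eq_true_eq]
        left
        apply Fin.ext
        show (R * d + ↑p) % d = ↑p
        rw [Nat.mul_comm, Nat.mul_add_mod, Nat.mod_eq_of_lt hp]
      · have hpd : (p : ℕ) = d := le_antisymm (Nat.lt_succ_iff.mp p.isLt) (not_lt.mp hp)
        refine ⟨R * d + (d - 1), List.mem_map.2 ⟨d - 1, List.mem_range.2 (by omega), rfl⟩, ?_⟩
        simp only [Function.comp_apply, decide_eq_true_eq]
        right
        apply Fin.ext
        show (R * d + (d - 1)) % d + 1 = ↑p
        rw [Nat.mul_comm, Nat.mul_add_mod, Nat.mod_eq_of_lt (by omega), hpd]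
        omega
    omega

include hd in
/-- Residues are covered by any window of `d` consecutive positions. -/
theorem exists_window_mod (m₁ k : ℕ) (hk : k < d) : ∃ m, m₁ ≤ m ∧ m < m₁ + d ∧ m % d = k := by
  have hdm := Nat.div_add_mod m₁ d
  have hs : m₁ % d < d := Nat.mod_lt _ hd
  by_cases hks : m₁ % d ≤ k
  · refine ⟨d * (m₁ / d) + k, ?_, ?_, ?_⟩
    · omega
    · omega
    · rw [Nat.mul_add_mod, Nat.mod_eq_of_lt hk]
  · refine ⟨d * (m₁ / d + 1) + k, ?_, ?_, ?_⟩
    · rw [Nat.mul_succ]; omega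
    · rw [Nat.mul_succ]; omega
    · rw [Nat.mul_add_mod, Nat.mod_eq_of_lt hk]

/-- **BFK-locality of the chain** with `C K = K²`, for `R·d ≤ (d+1)²` steps in total. -/
theorem locality_hist (R : ℕ) (hR : R * d ≤ (d + 1) ^ 2) :
    LocalityBFK (fun K => K ^ 2) (hist d hd R) := by
  intro S m₁ m₂ h12 h2 hfree
  have hlen : (hist d hd R).length = R * d := hist_length d hd R
  have memT : ∀ k : Fin (d + 1), (k : ℕ) ∈ S.map Fin.valEmbedding ↔ k ∈ S :=
    fun k => Finset.mem_map' Fin.valEmbedding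
  set T : Finset ℕ := S.map Fin.valEmbedding with hT
  -- crossing-freeness in terms of residues
  have hfree' : ∀ m, m₁ ≤ m → m < m₂ → (m % d ∈ T ↔ m % d + 1 ∈ T) := by
    intro m ha hb
    have hm : m < (hist d hd R).length := lt_of_lt_of_le hb h2
    have key := hfree m hm ha hb
    rw [hist_get] at key
    have h1 : ((stepAt d hd m).i : ℕ) = m % d := rfl
    have h2' : ((stepAt d hd m).j : ℕ) = m % d + 1 := rfl
    rw [← memT, ← memT, h1, h2'] at key
    exact key
  -- members of the filtered set, in terms of residues
  have hF : ∀ m ∈ (Finset.range (hist d hd R).length).filter (fun m => m₁ ≤ m ∧ m < m₂ ∧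
        ∃ hm : m < (hist d hd R).length,
          ((hist d hd R).get ⟨m, hm⟩).i ∈ S ∧ ((hist d hd R).get ⟨m, hm⟩).j ∈ S),
      m < R * d ∧ m₁ ≤ m ∧ m < m₂ ∧ m % d ∈ T ∧ m % d + 1 ∈ T := by
    intro m hm
    rw [Finset.mem_filter, Finset.mem_range] at hm
    obtain ⟨hlt, ha, hb, hm', hi, hj⟩ := hm
    rw [hist_get] at hi hj
    rw [hlen] at hlt
    exact ⟨hlt, ha, hb, (memT _).2 hi, (memT _).2 hj⟩
  -- the abstract bound
  have hgoal : ∀ F : Finset ℕ, (∀ m ∈ F, m < R * d ∧ m₁ ≤ m ∧ m < m₂ ∧ m % d ∈ T ∧ m % d + 1 ∈ T) →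
      F.card ≤ S.card ^ 2 := by
    intro F hFm
    by_cases hall : ∀ k : Fin (d + 1), k ∈ S
    · -- `S = univ`: the whole history has `R·d ≤ (d+1)²` steps
      have hS : S = Finset.univ := Finset.eq_univ_iff_forall.2 hall
      have hsub : F ⊆ Finset.range (R * d) := fun m hm => Finset.mem_range.2 (hFm m hm).1
      calc F.card ≤ (Finset.range (R * d)).card := Finset.card_le_card hsub
        _ = R * d := Finset.card_range _
        _ ≤ (d + 1) ^ 2 := hR
        _ = S.card ^ 2 := by rw [hS, Finset.card_univ, Fintype.card_fin]
    · push Not at hall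
      obtain ⟨p, hp⟩ := hall
      rcases Nat.lt_or_ge (m₁ + d) m₂ with hlong | hshort
      · -- long block: all residues are linked, and `p ∉ S` empties everything
        have hlink : ∀ k, k < d → (k ∈ T ↔ k + 1 ∈ T) := by
          intro k hk
          obtain ⟨m, hm1, hm2, hmk⟩ := exists_window_mod d hd m₁ k hk
          have := hfree' m hm1 (by omega)
          rwa [hmk] at this
        have hchain : ∀ k, k ≤ d → (k ∈ T ↔ 0 ∈ T) := by
          intro k
          induction k with
          | zero => intro; exact Iff.rfl
          | succ k ih => intro hk; exact (hlink k (by omega)).symm.trans (ih (by omega))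
        have h0 : (0 : ℕ) ∉ T := fun h0 =>
          hp ((memT p).1 ((hchain (p : ℕ) (Nat.lt_succ_iff.mp p.isLt)).2 h0))
        have hnone : ∀ k, k ≤ d → k ∉ T := fun k hk hkT => h0 ((hchain k hk).1 hkT)
        have hsub : F ⊆ (∅ : Finset ℕ) := fun m hm =>
          absurd (hFm m hm).2.2.2.1 (hnone _ (Nat.mod_lt m hd).le)
        calc F.card ≤ (∅ : Finset ℕ).card := Finset.card_le_card hsub
          _ = 0 := Finset.card_empty
          _ ≤ S.card ^ 2 := Nat.zero_le _
      · -- short block: `m ↦ m % d` is injective on `F` and lands in `T`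
        have hmaps : Set.MapsTo (fun m => m % d) (F : Set ℕ) (T : Set ℕ) :=
          fun m hm => (hFm m hm).2.2.2.1
        have hinj : Set.InjOn (fun m => m % d) (F : Set ℕ) := by
          intro m hm m' hm' heq
          have hb := hFm m hm
          have hb' := hFm m' hm'
          change m % d = m' % d at heq
          rcases Nat.lt_or_ge m m' with hlt | hge
          · exfalso
            have hz : (m' - m) % d = 0 := Nat.sub_mod_eq_zero_of_mod_eq heq.symm
            have hdv : d ∣ m' - m := Nat.dvd_of_mod_eq_zero hz
            have hzero := Nat.eq_zero_of_dvd_of_lt hdv (by omega)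
            omega
          · rcases Nat.lt_or_ge m' m with hlt' | hge'
            · exfalso
              have hz : (m - m') % d = 0 := Nat.sub_mod_eq_zero_of_mod_eq heq
              have hdv : d ∣ m - m' := Nat.dvd_of_mod_eq_zero hz
              have hzero := Nat.eq_zero_of_dvd_of_lt hdv (by omega)
              omega
            · omega
        calc F.card ≤ T.card := Finset.card_le_card_of_injOn _ hmaps hinj
          _ = S.card := Finset.card_map _
          _ ≤ S.card ^ 2 := Nat.le_self_pow (by norm_num) _
  exact hgoal _ hF

end Hist

/-! ## The refutation -/

/-- **`CascadeCore` is false.** At `c₀ = 1/10`, `C K = K²`, `η = 7`: for every `m₀` the chain with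
`d = m₀ + 1` run for `d` rounds is admissible, fully `c₀`-non-degenerate, `C`-local, every particle
takes `≥ m₀ + 1` steps, and the (unchanged) masses have `Σ a² ≥ h² ≥ 64/9 > 7`. -/
theorem not_cascadeCore : ¬ CascadeCore := by
  intro hC
  obtain ⟨m₀, hm₀⟩ := hC (1 / 10) (by norm_num) (by norm_num) (fun K => K ^ 2) 7 (by norm_num)
  have hd : 0 < m₀ + 1 := Nat.succ_pos _
  have hR : (m₀ + 1) * (m₀ + 1) ≤ (m₀ + 1 + 1) ^ 2 := by
    rw [pow_two]; exact Nat.mul_le_mul (Nat.le_succ _) (Nat.le_succ _)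
  have key := hm₀ (m₀ + 1 + 1) (mass (m₀ + 1)) (hist (m₀ + 1) hd (m₀ + 1)) (mass_nonneg (m₀ + 1))
    (mass_sum (m₀ + 1)) (admissible_hist (m₀ + 1) hd (m₀ + 1)) (fullyND_hist (m₀ + 1) hd (m₀ + 1))
    (locality_hist (m₀ + 1) hd (m₀ + 1) hR)
    (fun i => (Nat.le_succ m₀).trans (stepsOf_hist_ge (m₀ + 1) hd (m₀ + 1) i))
  rw [massesAfter_hist] at key
  have h0 : (mass (m₀ + 1) 0) ^ 2 ≤ ∑ i, (mass (m₀ + 1) i) ^ 2 :=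
    Finset.single_le_sum (f := fun i => (mass (m₀ + 1) i) ^ 2) (fun i _ => sq_nonneg _)
      (Finset.mem_univ _)
  rw [mass_zero] at h0
  have hge := hmass_ge (m₀ + 1)
  nlinarith [pow_le_pow_left₀ (by norm_num : (0 : ℝ) ≤ 8 / 3) hge 2]

end

end Summit.AtomisticToContinuum.HydrodynamicLimit.Cruxes.DiffuseBackwardInfluence.TriageR1K3General
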